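import Literature.Geometry.Riemannian.HamiltonPCOPinchingFive
import Literature.Geometry.Riemannian.PinchingEstimatesAlgebra
import HarnessLib

/-!
# Hamilton's pinching set is invariant under `O(4)`: conjugation by `O(3) × O(3)` and the swap
(topic `Geometry/Riemannian`)

Def. 5.1 (2) of **Hamilton 1986** (J. Differential Geom. 24, p. 163) asks a pinching set to be
"invariant under the action of the Lie group `O(n)`", and Thm. 7.1 (p. 171) checks it for the set
`Z` of positive curvature operators: "It is clear that `Z` is invariant under the action of `O(4)`
on the space of matrices `M`, because this action first induces rotations on `Λ²₊` and `Λ²₋` and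
these leave the eigenvalues unchanged." In the block form `M = (A B; ᵗB C)` the induced action of
`SO(4)` is conjugation `(A, B, C) ↦ (PAᵗP, PBᵗQ, QCᵗQ)` by pairs of rotations `(P, Q)` of
`Λ²₊ ≅ ℝ³`, `Λ²₋ ≅ ℝ³`, and an orientation-reversing element exchanges `Λ²₊` and `Λ²₋`
(`(A, B, C) ↦ (C, ᵗB, A)`, `HamiltonODE.swapAC`, `PinchingEstimatesAlgebra.lean`). This file PROVES
that the tree's pinching set `Z = pcoPinchingFive m G H J δ K ε L θ` (`HamiltonPCOPinchingFive.lean`)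
is invariant under both (`conjBlocks_mem_pcoPinchingFive` for all orthogonal `P`, `Q` — a fortiori
for rotations — and `swapAC_mem_pcoPinchingFive`): every defining condition quantifies over all unit
vectors, orthonormal pairs and orthogonal `T`, which are permuted by the action. (In the frame-wise
formulation of the maximum principle `hamilton_maximumPrinciple_curvatureODE`, which quantifies over
all orthonormal frames, this invariance is automatic; the present file records it as printed.)

## References

* R. S. Hamilton, *Four-manifolds with positive curvature operator*, J. Differential Geom. 24
  (1986) 153–179: §5, Def. 5.1 (p. 163); §7, Thm. 7.1 (pp. 170–171). [Hamilton1986]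
-/

noncomputable section

open Set Real
open scoped Matrix BigOperators

namespace Literature.Geometry.Riemannian

namespace HamiltonODE

/-! ### Conjugation by `O(3) × O(3)` -/

/-- **The action of `SO(3) × SO(3) ⊆ SO(4)` on block triples**: `(A, B, C) ↦ (PAᵗP, PBᵗQ, QCᵗQ)`
(rotating the bases of `Λ²₊` by `P` and of `Λ²₋` by `Q`). [cite: Hamilton1986, §7, Thm. 7.1 (p. 171)] -/
def conjBlocks (P Q : Matrix (Fin 3) (Fin 3) ℝ) (p : Blocks) : Blocks :=
  (P * p.1 * Pᵀ, P * p.2.1 * Qᵀ, Q * p.2.2 * Qᵀ)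

section Conj

variable {P Q : Matrix (Fin 3) (Fin 3) ℝ} (hP : Pᵀ * P = 1) (hQ : Qᵀ * Q = 1)

/-- `ᵗu (P X ᵗQ) v = ᵗ(ᵗP u) X (ᵗQ v)`. [folklore] -/
theorem dotProduct_conj_mulVec (P X Q : Matrix (Fin 3) (Fin 3) ℝ) (u v : Fin 3 → ℝ) :
    u ⬝ᵥ ((P * X * Qᵀ) *ᵥ v) = (Pᵀ *ᵥ u) ⬝ᵥ (X *ᵥ (Qᵀ *ᵥ v)) := by
  rw [Matrix.mul_assoc, ← Matrix.mulVec_mulVec, ← Matrix.mulVec_mulVec, ← Matrix.dotProduct_transpose_mulVec,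
    dotProduct_comm]

include hP in
/-- `ᵗP` preserves dot products (`P ᵗP = 1`). [folklore] -/
theorem dotProduct_transpose_mulVec_of_orthogonal (u v : Fin 3 → ℝ) :
    (Pᵀ *ᵥ u) ⬝ᵥ (Pᵀ *ᵥ v) = u ⬝ᵥ v := by
  have hPP := mul_transpose_self_of_orthogonal hP
  rw [← Matrix.dotProduct_transpose_mulVec, Matrix.transpose_transpose, Matrix.mulVec_mulVec, hPP,
    Matrix.one_mulVec, dotProduct_comm]

omit hP hQ in
/-- The block quadratic form transforms by `M_{PQ}((x, y)) = M((ᵗPx, ᵗQy))`. [folklore] -/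
theorem quad_conjBlocks (p : Blocks) (x y : Fin 3 → ℝ) :
    quad (conjBlocks P Q p) (x, y) = quad p (Pᵀ *ᵥ x, Qᵀ *ᵥ y) := by
  simp only [quad, conjBlocks, dotProduct_conj_mulVec]

include hP hQ in
/-- `M ≥ m` is invariant. [folklore] -/
theorem OperatorGE.conjBlocks {p : Blocks} {m : ℝ} (h : OperatorGE p m) : OperatorGE (conjBlocks P Q p) m := by
  rintro ⟨x, y⟩
  rw [quad_conjBlocks]
  have := h (Pᵀ *ᵥ x, Qᵀ *ᵥ y)
  simpa only [normSq, dotProduct_transpose_mulVec_of_orthogonal hP, dotProduct_transpose_mulVec_of_orthogonal hQ]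
    using this

include hP in
/-- The trace of a block is invariant. [folklore] -/
theorem trace_conj (X : Matrix (Fin 3) (Fin 3) ℝ) : (P * X * Pᵀ).trace = X.trace := by
  rw [Matrix.trace_mul_cycle, hP, Matrix.one_mul]

omit hP hQ in
/-- `tr ((P B ᵗQ) T) = tr (B (ᵗQ T P))` (and `ᵗQ T P` is orthogonal when `T` is). [folklore] -/
theorem trace_conj_mul (B T : Matrix (Fin 3) (Fin 3) ℝ) :
    (P * B * Qᵀ * T).trace = (B * (Qᵀ * T * P)).trace := by
  rw [show P * B * Qᵀ * T = P * (B * (Qᵀ * T)) by simp only [Matrix.mul_assoc], Matrix.trace_mul_comm,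
    show B * (Qᵀ * T) * P = B * (Qᵀ * T * P) by simp only [Matrix.mul_assoc]]

include hP hQ in
/-- `ᵗQ T P` is orthogonal for orthogonal `T`. [folklore] -/
theorem orthogonal_conj_of_orthogonal {T : Matrix (Fin 3) (Fin 3) ℝ} (hT : Tᵀ * T = 1) :
    (Qᵀ * T * P)ᵀ * (Qᵀ * T * P) = 1 := by
  have hQQ := mul_transpose_self_of_orthogonal hQ
  rw [Matrix.transpose_mul, Matrix.transpose_mul, Matrix.transpose_transpose]
  calc Pᵀ * (Tᵀ * Q) * (Qᵀ * T * P) = Pᵀ * (Tᵀ * (Q * Qᵀ) * T) * P := by simp only [Matrix.mul_assoc]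
    _ = 1 := by rw [hQQ, Matrix.mul_one, hT, Matrix.mul_one, hP]

include hP in
/-- Unit vectors go to unit vectors, … [folklore] -/
theorem unit_transpose_mulVec {u : Fin 3 → ℝ} (hu : u ⬝ᵥ u = 1) : (Pᵀ *ᵥ u) ⬝ᵥ (Pᵀ *ᵥ u) = 1 := by
  rw [dotProduct_transpose_mulVec_of_orthogonal hP, hu]

include hP in
/-- … orthogonal ones to orthogonal ones. [folklore] -/
theorem orth_transpose_mulVec {u v : Fin 3 → ℝ} (huv : u ⬝ᵥ v = 0) : (Pᵀ *ᵥ u) ⬝ᵥ (Pᵀ *ᵥ v) = 0 := by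
  rw [dotProduct_transpose_mulVec_of_orthogonal hP, huv]

include hP hQ in
/-- **`Z` is invariant under conjugation by `O(3) × O(3)`** ("this action first induces rotations
on `Λ²₊` and `Λ²₋` and these leave the eigenvalues unchanged", Thm. 7.1, p. 171).
[cite: Hamilton1986, §7, Thm. 7.1 (p. 171); §5, Def. 5.1 (2) (p. 163)] -/
theorem conjBlocks_mem_pcoPinchingFive {m G H J δ K ε L θ : ℝ} {p : Blocks}
    (h : p ∈ pcoPinchingFive m G H J δ K ε L θ) : conjBlocks P Q p ∈ pcoPinchingFive m G H J δ K ε L θ := by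
  obtain ⟨⟨⟨⟨⟨hA, hC⟩, htr, hop, h1, h2A, h2C⟩, h3⟩, h4⟩, h5A, h5C⟩ := h
  have uP := fun {u : Fin 3 → ℝ} (hu : u ⬝ᵥ u = 1) ↦ unit_transpose_mulVec hP hu
  have uQ := fun {u : Fin 3 → ℝ} (hu : u ⬝ᵥ u = 1) ↦ unit_transpose_mulVec hQ hu
  have oP := fun {u v : Fin 3 → ℝ} (huv : u ⬝ᵥ v = 0) ↦ orth_transpose_mulVec hP huv
  have oQ := fun {u v : Fin 3 → ℝ} (huv : u ⬝ᵥ v = 0) ↦ orth_transpose_mulVec hQ huv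
  refine ⟨⟨⟨⟨⟨isSymm_conj hA P, isSymm_conj hC Q⟩, ?_, hop.conjBlocks hP hQ, ?_, ?_, ?_⟩, ?_⟩, ?_⟩, ?_, ?_⟩
  · simp only [conjBlocks, trace_conj hP, trace_conj hQ, htr]
  · -- (1)
    intro u₁ u₂ v₁ v₂ w z hu₁ hu₂ hu hv₁ hv₂ hv hw hz
    simp only [conjBlocks, dotProduct_conj_mulVec]
    exact h1 _ _ _ _ _ _ (uP hu₁) (uP hu₂) (oP hu) (uQ hv₁) (uQ hv₂) (oQ hv) (uP hw) (uQ hz)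
  · -- (2), block `A`
    intro u w hu hw
    simp only [conjBlocks, dotProduct_conj_mulVec]
    exact h2A _ _ (uP hu) (uP hw)
  · -- (2), block `C`
    intro u w hu hw
    simp only [conjBlocks, dotProduct_conj_mulVec]
    exact h2C _ _ (uQ hu) (uQ hw)
  · -- (3)
    intro u₁ u₂ v₁ v₂ w z T hu₁ hu₂ hu hv₁ hv₂ hv hw hz hT
    simp only [conjBlocks, dotProduct_conj_mulVec, trace_conj hP, trace_conj hQ, trace_conj_mul]
    exact h3 _ _ _ _ _ _ (Qᵀ * T * P) (uP hu₁) (uP hu₂) (oP hu) (uQ hv₁) (uQ hv₂) (oQ hv) (uP hw) (uQ hz)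
      (orthogonal_conj_of_orthogonal hP hQ hT)
  · -- (4)
    intro u₁ u₂ v₁ v₂ w z hu₁ hu₂ hu hv₁ hv₂ hv hw hz
    simp only [conjBlocks, dotProduct_conj_mulVec]
    exact h4 _ _ _ _ _ _ (uP hu₁) (uP hu₂) (oP hu) (uQ hv₁) (uQ hv₂) (oQ hv) (uP hw) (uQ hz)
  · -- (5), block `A`
    intro u w hu hw
    simp only [conjBlocks, dotProduct_conj_mulVec]
    exact h5A _ _ (uP hu) (uP hw)
  · -- (5), block `C`
    intro u w hu hw
    simp only [conjBlocks, dotProduct_conj_mulVec]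
    exact h5C _ _ (uQ hu) (uQ hw)

end Conj

/-! ### The swap `(A, B, C) ↦ (C, ᵗB, A)` -/

/-- The block quadratic form transforms by `M_swap((x, y)) = M((y, x))`. [folklore] -/
theorem quad_swapAC (p : Blocks) (x y : Fin 3 → ℝ) : quad (swapAC p) (x, y) = quad p (y, x) := by
  simp only [quad, swapAC, Matrix.dotProduct_transpose_mulVec]
  ring

/-- `M ≥ m` is invariant under the swap. [folklore] -/
theorem OperatorGE.swapAC {p : Blocks} {m : ℝ} (h : OperatorGE p m) : OperatorGE (swapAC p) m := by
  rintro ⟨x, y⟩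
  rw [quad_swapAC]
  have := h (y, x)
  simp only [normSq] at this ⊢
  linarith

/-- **`Z` is invariant under the exchange of `Λ²₊` and `Λ²₋`** (the orientation-reversing part of
`O(4)`; "A similar argument works for the inequality in `c`"). [cite: Hamilton1986, §7, Thm. 7.1 (p. 171); §5, Def. 5.1 (2) (p. 163)] -/
theorem swapAC_mem_pcoPinchingFive {m G H J δ K ε L θ : ℝ} {p : Blocks}
    (h : p ∈ pcoPinchingFive m G H J δ K ε L θ) : swapAC p ∈ pcoPinchingFive m G H J δ K ε L θ := by
  obtain ⟨⟨⟨⟨⟨hA, hC⟩, htr, hop, h1, h2A, h2C⟩, h3⟩, h4⟩, h5A, h5C⟩ := h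
  refine ⟨⟨⟨⟨⟨hC, hA⟩, htr.symm, hop.swapAC, ?_, h2C, h2A⟩, ?_⟩, ?_⟩, h5C, h5A⟩
  · -- (1)
    intro u₁ u₂ v₁ v₂ w z hu₁ hu₂ hu hv₁ hv₂ hv hw hz
    simp only [swapAC_fst, swapAC_snd_fst, swapAC_snd_snd, Matrix.dotProduct_transpose_mulVec]
    have := h1 v₁ v₂ u₁ u₂ z w hv₁ hv₂ hv hu₁ hu₂ hu hz hw
    linarith
  · -- (3): `T ↦ ᵗT`
    intro u₁ u₂ v₁ v₂ w z T hu₁ hu₂ hu hv₁ hv₂ hv hw hz hT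
    simp only [swapAC_fst, swapAC_snd_fst, swapAC_snd_snd, Matrix.dotProduct_transpose_mulVec]
    have hTt : Tᵀᵀ * Tᵀ = 1 := by rw [Matrix.transpose_transpose]; exact mul_transpose_self_of_orthogonal hT
    have := h3 v₁ v₂ u₁ u₂ z w Tᵀ hv₁ hv₂ hv hu₁ hu₂ hu hz hw hTt
    have e : (p.2.1ᵀ * T).trace = (p.2.1 * Tᵀ).trace := by
      rw [← Matrix.trace_transpose, Matrix.transpose_mul, Matrix.transpose_transpose, Matrix.trace_mul_comm]
    rw [e]
    have e2 : p.2.2.trace - 2 * (p.2.1 * Tᵀ).trace + p.1.trace = p.1.trace - 2 * (p.2.1 * Tᵀ).trace + p.2.2.trace := by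
      ring
    rw [e2]
    linarith
  · -- (4)
    intro u₁ u₂ v₁ v₂ w z hu₁ hu₂ hu hv₁ hv₂ hv hw hz
    simp only [swapAC_fst, swapAC_snd_fst, swapAC_snd_snd, Matrix.dotProduct_transpose_mulVec]
    have := h4 v₁ v₂ u₁ u₂ z w hv₁ hv₂ hv hu₁ hu₂ hu hz hw
    have e : (v₁ ⬝ᵥ (p.2.1 *ᵥ u₁) + v₂ ⬝ᵥ (p.2.1 *ᵥ u₂)) ^ 2 = (v₁ ⬝ᵥ (p.2.1 *ᵥ u₁) + v₂ ⬝ᵥ (p.2.1 *ᵥ u₂)) ^ 2 := rfl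
    nlinarith [this]

end HamiltonODE

end Literature.Geometry.Riemannian

end
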